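import Mathlib
import HarnessLib
import Summits.HubbardSuperconductivity.HubbardSuperconductivity.Theorems.KLProgrammeKLRegimeEngineTwoLegCellReaderEffAction
import Summits.HubbardSuperconductivity.HubbardSuperconductivity.Theorems.KLProgrammeKLRegimeSectorSlicePairMoment

/-!
# Route `KLProgramme` — crux K3 ENGINE (stmt-HubbardSuperconductivity-20437 `KLRegimeEngineV17F2`), row (b), E1 docket item (2) «(E2)-CELL-READER», part 5:
# the input-family two-leg cell of `𝒱_i[K]` from MIXED-ORDER symbol data (the «W1-MIXED»-compatible E1 face)

Cell `gate-hubbard-kl`, seat hubbard-kl-k3c2-p3 (g19).  Sequel of `…EngineTwoLegCellReaderEffAction` (part 4).  Part 4's data face asks THIRD single-direction differences in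
all five directions, in particular along the tangential frame vector `v` at the anisotropic rate `s₃` (`s₃|v| ≍ 2^{−J}`).  The located risk «W1-MIXED» (KL STATUS, p3 g10)
showed for the slice PROPAGATOR that the tangential third difference at the anisotropic rate is the delicate datum; p3's mixed master lemma
(`sum_wt_norm_charSum_le_of_mixed_differences`) and k3c3-p2's per-pair form `sliceCharSumWt_l1_le_of_mixed_data` read `v` at order TWO at rate `s₃` and at order THREE at an
isotropic rate `s₃′` instead.  This file is the corresponding face for the two-leg SYMBOL:

* **`klWtPinnedSumOf_two_klEffectiveAction_le_of_mixedData`** — `klWtPinnedSumOf L M β μ K J 2 (𝒱_i[K]) q w ≤ ε_x·Σ_{ℓ′} √(524288(1/s₀+1)[…])·√(24·2M·L²·N_s(ℓ′))·A₀(ℓ′)` from,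
  per partner label: support count, sup, third differences of `1·((F_{J,ω}F_{J,ω′})·Ŵ₂^{τ(q)})` in time / axes / `v⊥` / `v` (rate `s₃′`) and SECOND differences along `v`
  (rate `s₃`) — no structural hypothesis on the kernel (part 4).

Everything is proved; no definitions, no named facts; nothing here asserts (E2), any engine row, K3 or superconductivity. [folklore]
References: BGM 2006 Lemma 2.2 (2.52)–(2.55), §2.8 (2.76), (2.81) [cite: BenfattoGiulianiMastropietro2006].
-/

noncomputable section

namespace Summit.HubbardSuperconductivity.HubbardSuperconductivity.Theorems.TorusFourierL2

set_option linter.dupNamespace false -- summit = problem name (single-conjunct summit), D-0017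

open Finset Complex Literature.Probability.LatticeModels Literature.MathematicalPhysics.QuantumLattice
open Literature.MathematicalPhysics.QuantumLattice.GrassmannAlgebra
open Summit.HubbardSuperconductivity.HubbardSuperconductivity.Theorems.KLRegimeSplit
open Summit.HubbardSuperconductivity.HubbardSuperconductivity.Theorems.KLProgrammeLegKernels
open Summit.HubbardSuperconductivity.HubbardSuperconductivity.Theorems.EngineV8
open scoped Real ComplexConjugate

variable {L M : ℕ} [NeZero L] [NeZero M]

/-- **(E2) FROM MIXED-ORDER DATA OF THE ACTUAL TWO-LEG SYMBOL** (the «W1-MIXED»-compatible face): as `…_le_of_symbolData` (part 4) but with the tangential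
direction `v` read at order TWO at the anisotropic rate `s₃` and at order THREE at an isotropic rate `s₃′` (k3c3-p2's `sliceCharSumWt_l1_le_of_mixed_data`, p3 g10's mixed
master lemma): `klWtPinnedSumOf L M β μ K J 2 (𝒱_i[K]) q w ≤ ε_x·Σ_{ℓ′} √(524288(1/s₀+1)[C_w′²(…)(…) + (1/s₁+1)²/(1+s₁R₀)])·√(24·2M·L²·N_s(ℓ′))·A₀(ℓ′)`.
[cite: BenfattoGiulianiMastropietro2006, Lemma 2.2 (2.52), §2.8 (2.76), (2.81)] -/
theorem klWtPinnedSumOf_two_klEffectiveAction_le_of_mixedData {β : ℝ} (hβ : 0 < β) (U μ : ℝ) (K : TrigPolyC4v) (i J : ℕ) (q : Fin 2)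
    (w : SpaceTimeIdx L M × SectorLeg (sectorCount J))
    (v : Fin 2 → ℤ) (hv : v ≠ 0) {s₂ s₃ s₃' : ℝ} (hs₂ : 0 < s₂) (hs₃ : 0 < s₃) (hs₃' : 0 < s₃') {R₀ : ℕ} (hR₀ : 2 * (|v 0| + |v 1|) * (R₀ : ℤ) < L)
    (Ns : SectorLeg (sectorCount J) → ℕ) (A₀ : SectorLeg (sectorCount J) → ℝ) (hA₀ : ∀ ℓ', 0 ≤ A₀ ℓ')
    (hsupp : ∀ ℓ' : SectorLeg (sectorCount J), (univ.filter fun Q : TorusSite 1 (2 * M) × TorusSite 2 L =>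
        klAnisoFamily L M β μ K klE0 J w.2.1.1 (⟨(Q.1 0).val, ZMod.val_lt (Q.1 0)⟩, Q.2) *
          klAnisoFamily L M β μ K klE0 J ℓ'.1.1 (⟨(Q.1 0).val, ZMod.val_lt (Q.1 0)⟩, Q.2) ≠ 0).card ≤ Ns ℓ')
    (hsup : ∀ (ℓ' : SectorLeg (sectorCount J)) (Q : TorusSite 1 (2 * M) × TorusSite 2 L),
      ‖(1 : ℂ) * (klAnisoFamily L M β μ K klE0 J w.2.1.1 (⟨(Q.1 0).val, ZMod.val_lt (Q.1 0)⟩, Q.2) *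
          klAnisoFamily L M β μ K klE0 J ℓ'.1.1 (⟨(Q.1 0).val, ZMod.val_lt (Q.1 0)⟩, Q.2) *
        kernel ℂ (klEffectiveAction L M β U μ K klE0 i) 2
                (fun j => (((⟨(Q.1 0).val, ZMod.val_lt (Q.1 0)⟩, Q.2), ((fun j : Fin 2 => if j = q then (w.2.1.2, w.2.2) else (ℓ'.1.2, ℓ'.2)) j).1),
                  ((fun j : Fin 2 => if j = q then (w.2.1.2, w.2.2) else (ℓ'.1.2, ℓ'.2)) j).2)))‖ ≤ A₀ ℓ')
    (h₀ : ∀ (ℓ' : SectorLeg (sectorCount J)) (Q : TorusSite 1 (2 * M) × TorusSite 2 L),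
      ‖(fwdDiff ((fun _ : Fin 1 => (1 : ZMod (2 * M))), (0 : TorusSite 2 L)))^[3]
        (fun y : TorusSite 1 (2 * M) × TorusSite 2 L => (1 : ℂ) * (klAnisoFamily L M β μ K klE0 J w.2.1.1 (⟨(y.1 0).val, ZMod.val_lt (y.1 0)⟩, y.2) *
          klAnisoFamily L M β μ K klE0 J ℓ'.1.1 (⟨(y.1 0).val, ZMod.val_lt (y.1 0)⟩, y.2) *
          kernel ℂ (klEffectiveAction L M β U μ K klE0 i) 2
                (fun j => (((⟨(y.1 0).val, ZMod.val_lt (y.1 0)⟩, y.2), ((fun j : Fin 2 => if j = q then (w.2.1.2, w.2.2) else (ℓ'.1.2, ℓ'.2)) j).1),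
                  ((fun j : Fin 2 => if j = q then (w.2.1.2, w.2.2) else (ℓ'.1.2, ℓ'.2)) j).2)))) Q‖ ≤ A₀ ℓ' * (4 / (klScale klE0 J * β)) ^ 3)
    (h₁ : ∀ (ℓ' : SectorLeg (sectorCount J)) (Q : TorusSite 1 (2 * M) × TorusSite 2 L) (e : Fin 2),
      ‖(fwdDiff ((0 : TorusSite 1 (2 * M)), (Pi.single e (1 : ZMod L) : TorusSite 2 L)))^[3]
        (fun y : TorusSite 1 (2 * M) × TorusSite 2 L => (1 : ℂ) * (klAnisoFamily L M β μ K klE0 J w.2.1.1 (⟨(y.1 0).val, ZMod.val_lt (y.1 0)⟩, y.2) *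
          klAnisoFamily L M β μ K klE0 J ℓ'.1.1 (⟨(y.1 0).val, ZMod.val_lt (y.1 0)⟩, y.2) *
          kernel ℂ (klEffectiveAction L M β U μ K klE0 i) 2
                (fun j => (((⟨(y.1 0).val, ZMod.val_lt (y.1 0)⟩, y.2), ((fun j : Fin 2 => if j = q then (w.2.1.2, w.2.2) else (ℓ'.1.2, ℓ'.2)) j).1),
                  ((fun j : Fin 2 => if j = q then (w.2.1.2, w.2.2) else (ℓ'.1.2, ℓ'.2)) j).2)))) Q‖ ≤ A₀ ℓ' * (4 / (klScale klE0 J * L)) ^ 3)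
    (h₂ : ∀ (ℓ' : SectorLeg (sectorCount J)) (Q : TorusSite 1 (2 * M) × TorusSite 2 L),
      ‖(fwdDiff ((0 : TorusSite 1 (2 * M)), (fun j => ((![-v 1, v 0] j : ℤ) : ZMod L))))^[3]
        (fun y : TorusSite 1 (2 * M) × TorusSite 2 L => (1 : ℂ) * (klAnisoFamily L M β μ K klE0 J w.2.1.1 (⟨(y.1 0).val, ZMod.val_lt (y.1 0)⟩, y.2) *
          klAnisoFamily L M β μ K klE0 J ℓ'.1.1 (⟨(y.1 0).val, ZMod.val_lt (y.1 0)⟩, y.2) *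
          kernel ℂ (klEffectiveAction L M β U μ K klE0 i) 2
                (fun j => (((⟨(y.1 0).val, ZMod.val_lt (y.1 0)⟩, y.2), ((fun j : Fin 2 => if j = q then (w.2.1.2, w.2.2) else (ℓ'.1.2, ℓ'.2)) j).1),
                  ((fun j : Fin 2 => if j = q then (w.2.1.2, w.2.2) else (ℓ'.1.2, ℓ'.2)) j).2)))) Q‖ ≤ A₀ ℓ' * (4 / (s₂ * L)) ^ 3)
    (h₃ : ∀ (ℓ' : SectorLeg (sectorCount J)) (Q : TorusSite 1 (2 * M) × TorusSite 2 L),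
      ‖(fwdDiff ((0 : TorusSite 1 (2 * M)), (fun j => ((v j : ℤ) : ZMod L))))^[2]
        (fun y : TorusSite 1 (2 * M) × TorusSite 2 L => (1 : ℂ) * (klAnisoFamily L M β μ K klE0 J w.2.1.1 (⟨(y.1 0).val, ZMod.val_lt (y.1 0)⟩, y.2) *
          klAnisoFamily L M β μ K klE0 J ℓ'.1.1 (⟨(y.1 0).val, ZMod.val_lt (y.1 0)⟩, y.2) *
          kernel ℂ (klEffectiveAction L M β U μ K klE0 i) 2
                (fun j => (((⟨(y.1 0).val, ZMod.val_lt (y.1 0)⟩, y.2), ((fun j : Fin 2 => if j = q then (w.2.1.2, w.2.2) else (ℓ'.1.2, ℓ'.2)) j).1),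
                  ((fun j : Fin 2 => if j = q then (w.2.1.2, w.2.2) else (ℓ'.1.2, ℓ'.2)) j).2)))) Q‖ ≤ A₀ ℓ' * (4 / (s₃ * L)) ^ 2)
    (h₃' : ∀ (ℓ' : SectorLeg (sectorCount J)) (Q : TorusSite 1 (2 * M) × TorusSite 2 L),
      ‖(fwdDiff ((0 : TorusSite 1 (2 * M)), (fun j => ((v j : ℤ) : ZMod L))))^[3]
        (fun y : TorusSite 1 (2 * M) × TorusSite 2 L => (1 : ℂ) * (klAnisoFamily L M β μ K klE0 J w.2.1.1 (⟨(y.1 0).val, ZMod.val_lt (y.1 0)⟩, y.2) *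
          klAnisoFamily L M β μ K klE0 J ℓ'.1.1 (⟨(y.1 0).val, ZMod.val_lt (y.1 0)⟩, y.2) *
          kernel ℂ (klEffectiveAction L M β U μ K klE0 i) 2
                (fun j => (((⟨(y.1 0).val, ZMod.val_lt (y.1 0)⟩, y.2), ((fun j : Fin 2 => if j = q then (w.2.1.2, w.2.2) else (ℓ'.1.2, ℓ'.2)) j).1),
                  ((fun j : Fin 2 => if j = q then (w.2.1.2, w.2.2) else (ℓ'.1.2, ℓ'.2)) j).2)))) Q‖ ≤ A₀ ℓ' * (4 / (s₃' * L)) ^ 3) :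
    klWtPinnedSumOf L M β μ K J 2 (klEffectiveAction L M β U μ K klE0 i) q w ≤
      imagTimeWeight β M * ∑ ℓ' : SectorLeg (sectorCount J),
        Real.sqrt (524288 * (1 / (klScale klE0 J * β / (2 * M)) + 1) *
            ((1 + 2 * Real.sqrt 2 * klScale klE0 J / (s₂ * Real.sqrt ((v 0 : ℝ) ^ 2 + (v 1 : ℝ) ^ 2)) +
                2 * Real.sqrt 2 * klScale klE0 J / (s₃' * Real.sqrt ((v 0 : ℝ) ^ 2 + (v 1 : ℝ) ^ 2))) ^ 2 *
              ((2 * Real.sqrt 2 / (s₂ * Real.sqrt ((v 0 : ℝ) ^ 2 + (v 1 : ℝ) ^ 2)) + 2) *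
                (2 * Real.sqrt 2 / (s₃ * Real.sqrt ((v 0 : ℝ) ^ 2 + (v 1 : ℝ) ^ 2)) + 2))
              + (1 / klScale klE0 J + 1) ^ 2 / (1 + klScale klE0 J * R₀))) *
          Real.sqrt (24 * ((2 * M : ℕ) : ℝ) * (L : ℝ) ^ 2 * Ns ℓ') * A₀ ℓ' := by
  haveI : NeZero (2 * M) := ⟨by have := NeZero.ne M; omega⟩
  have hΛ : 0 < klScale klE0 J := klth_klScale_pos J
  have hM0 : (0 : ℝ) < M := by exact_mod_cast Nat.pos_of_ne_zero (NeZero.ne M)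
  have hs₀ : 0 < klScale klE0 J * β / (2 * M) := by positivity
  have hP : klScale klE0 J * β / (2 * M) * ((2 * M : ℕ) : ℝ) = klScale klE0 J * β := by
    push_cast; field_simp
  refine (klWtPinnedSumOf_two_klEffectiveAction_le hβ U μ K i J q w).trans
    (mul_le_mul_of_nonneg_left (Finset.sum_le_sum fun ℓ' _ => ?_) (imagTimeWeight_nonneg hβ.le M))
  have h := sliceCharSumWt_l1_le_of_mixed_data (1 : ℂ)
    (fun Q : TorusSite 1 (2 * M) × TorusSite 2 L => klAnisoFamily L M β μ K klE0 J w.2.1.1 (⟨(Q.1 0).val, ZMod.val_lt (Q.1 0)⟩, Q.2) *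
          klAnisoFamily L M β μ K klE0 J ℓ'.1.1 (⟨(Q.1 0).val, ZMod.val_lt (Q.1 0)⟩, Q.2))
    (fun Q : TorusSite 1 (2 * M) × TorusSite 2 L => kernel ℂ (klEffectiveAction L M β U μ K klE0 i) 2
                (fun j => (((⟨(Q.1 0).val, ZMod.val_lt (Q.1 0)⟩, Q.2), ((fun j : Fin 2 => if j = q then (w.2.1.2, w.2.2) else (ℓ'.1.2, ℓ'.2)) j).1),
                  ((fun j : Fin 2 => if j = q then (w.2.1.2, w.2.2) else (ℓ'.1.2, ℓ'.2)) j).2))) v hv hs₀ hΛ hs₂ hs₃ hs₃' hR₀ (hA₀ ℓ') (hsupp ℓ') (hsup ℓ')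
    (fun Q => by rw [hP]; exact h₀ ℓ' Q) (h₁ ℓ') (h₂ ℓ') (h₃ ℓ') (h₃' ℓ')
  simpa only [one_mul] using h

end Summit.HubbardSuperconductivity.HubbardSuperconductivity.Theorems.TorusFourierL2

end
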